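import Literature.NumberTheory.Automorphic.ACCAutomorphyLiftingCrystalline
import Literature.NumberTheory.Automorphic.Qian2022PotentialAutomorphy
import Literature.NumberTheory.Automorphic.EssConjSelfDual
import Literature.NumberTheory.GaloisRepresentations.AbsGaloisOuterConj
import Literature.NumberTheory.GaloisRepresentations.SteinbergShapedPlace
import Literature.NumberTheory.GaloisRepresentations.WeilDeligneOfGalois
import Literature.NumberTheory.GaloisRepresentations.ModPGaloisRep
import Literature.NumberTheory.GaloisRepresentations.OrdinaryRegular
import HarnessLib

/-!
# Allen–Newton–Thorne 2020, Thm. 1.1 (= Thm. 6.1): automorphy lifting for residually reducible,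
# ordinary, conjugate self-dual `l`-adic Galois representations over imaginary CM fields with a
# Steinberg place

Topic `NumberTheory/Automorphic`; work item `wi-40757` (route `route-Langlands-EisensteinDegreeShift`,
"the printed polarizable sibling of crux `EisensteinSeededLifting`").  Pattern of
`Thorne2017AutomorphyLifting.lean` (`Thorne2017.automorphyLifting_unitary_ordinaryMinimal`) and
`Qian2022PotentialAutomorphy.lean`: ONE named fact (D-0014), local Artin data `𝓐` a parameter.

P. B. Allen, J. Newton, J. A. Thorne, *Automorphy lifting for residually reducible `l`-adic Galois
representations, II*, Compositio Math. 156 (2020) 2399–2422 (held text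
`paper:doi-10-1112-s0010437x20007484`, read 2026-08-17), **Theorem 1.1, pp. 2399–2400 (= Theorem 6.1,
pp. 2418–2419)**, as printed:

> Let `F` be an imaginary CM number field with maximal totally real subfield `F⁺` and let `n ≥ 2`
> be an integer. Let `l` be a prime and suppose that `ρ : G_F → GL_n(ℚ̄_l)` is a continuous
> semisimple representation satisfying the following hypotheses.
> (i) `ρ^c ≅ ρ^∨ ε^{1-n}`.
> (ii) `ρ` is ramified at only finitely many places.
> (iii) `ρ` is ordinary of weight `λ` for some `λ ∈ (ℤⁿ₊)^{Hom(F, ℚ̄_l)}`.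
> (iv) There is an isomorphism `ρ̄^{ss} ≅ ρ̄₁ ⊕ ⋯ ⊕ ρ̄_d`, where each `ρ̄_i` is absolutely
>   irreducible and satisfies `ρ̄_i^c ≅ ρ̄_i^∨ ε^{1-n}`, and `ρ̄_i ≇ ρ̄_j` if `i ≠ j`.
> (v) There exists a finite place `v₀` of `F`, prime to `l`, such that
>   `ρ|^{ss}_{G_{F_{v₀}}} ≅ ⊕_{i=1}^n ψ ε^{n-i}` for some unramified character `ψ : G_{F_{v₀}} → ℚ̄_l^×`.
> (vi) There exist a RACSDC representation `π` of `GL_n(𝔸_F)` and `ι : ℚ̄_l → ℂ` such that: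
>   (a) `π` is `ι`-ordinary; (b) `\overline{r_ι(π)}^{ss} ≅ ρ̄^{ss}`;
>   (c) `π_{v₀}` is an unramified twist of the Steinberg representation.
> (vii) `F(ζ_l)` is not contained in `F̄^{ker ad(ρ̄^{ss})}` and `F` is not contained in `F⁺(ζ_l)`.
>   For each `1 ≤ i, j ≤ d`, `ρ̄_i|_{G_{F(ζ_l)}}` is absolutely irreducible and
>   `ρ̄_i|_{G_{F(ζ_l)}} ≇ ρ̄_j|_{G_{F(ζ_l)}}` if `i ≠ j`. Moreover, `ρ̄^{ss}` is primitive (i.e. not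
>   induced from any proper subgroup of `G_F`) and `ρ̄^{ss}(G_F)` has no quotient of order `l`.
> (viii) `l > 3` and `l ∤ n`.
> Then `ρ` is automorphic: there exists an `ι`-ordinary RACSDC automorphic representation `Π` of
> `GL_n(𝔸_F)` such that `r_ι(Π) ≅ ρ`.

Conventions of the source (§1.1, pp. 2401–2402): "RACSDC" = regular algebraic, conjugate self-dual
(`π^c ≅ π^∨`), cuspidal; `r_ι(π)` is "characterized up to isomorphism by the requirement of
compatibility with the local Langlands correspondence at each finite place of `F`; see
[Tho15, Theorem 2.2]"; "`ρ` is automorphic if there exists a choice of `ι` and RACSDC `π` such that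
`ρ ≅ r_ι(π)`"; "`π` … `ι`-ordinary (see [Tho15, Lemma 2.3] …)"; "`ρ` is ordinary of weight `μ`"
following [Tho15, Def. 2.5] (upper triangular at each `v ∣ l` with diagonal characters
`ψ_i(Art_{F_v} σ) = ∏_τ τ(σ)^{-(μ_{τ,n-i+1}+i-1)}` on an open subgroup of `𝒪_{F_v}^×`).
Here [Tho15] = J. A. Thorne, J. Amer. Math. Soc. 28 (2015) 785–870 (bib key `Thorne2014`; held text
`paper:url-2526149c354b`, read 2026-08-17: Thm. 2.2 p. 794, Lemma 2.3 pp. 794–795, Thm. 2.4 p. 795,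
Def. 2.5 and Cor. 2.6 p. 797).

## Rendering, clause by clause (tree vocabulary; printed-EQUIVALENT unless marked)

* `F` imaginary CM: Mathlib `IsCMField F`, `F⁺ = maximalRealSubfield F`; a lift `c̃ ∈ Γ_{F⁺}` of
  complex conjugation (`absGaloisQuot F⁺ F c̃ = IsCMField.complexConj F`) gives the conjugate
  representations `ρ^c = ρ ∘ θ_{c̃}` (`FramedGaloisRep.outerConj`, `absGaloisOuterConj`), independent
  of the lift up to isomorphism.  "continuous semisimple": `FramedGaloisRep` (continuous by
  definition) with `ρ.toGaloisRep.IsSemisimple`.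
* Isomorphisms of SEMISIMPLE representations are rendered by equality of characteristic
  polynomials (Brauer–Nesbitt, the tree's discharged `brauerNesbitt_holds`, any characteristic):
  (i) `det(X - ρ^c(σ)) = det(X - ε(σ)^{1-n} ρ(σ)⁻¹)` for all `σ` (`ρ^∨(σ) = ᵗρ(σ)⁻¹` has the
  characteristic polynomial of `ρ(σ)⁻¹`; `ρ`, hence `ρ^c` and `ρ^∨ ε^{1-n}`, semisimple);
  likewise `ρ̄_i^c ≅ ρ̄_i^∨ ε̄^{1-n}` in (iv) (`ρ̄_i` irreducible), with the mod-`l` cyclotomic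
  character `modPCyclotomicCharacterZMod F l` pushed into `k = ℤ̄_l/𝔪` (`padicAlgClResidueField l`,
  an algebraic closure of `𝔽_l`, so "absolutely irreducible" = `IsAbsIrreducible` over `k`) along a
  ring map `ιk : ZMod l →+* k` (unique; a bound variable); "`≇`" of two (absolutely) irreducible
  representations = their characteristic polynomials differ at some `σ` (different dimensions give
  different degrees).
* `ρ̄^{ss}`: a residual representation `τ` of `ρ` (`IsResidualRepOf`: a semisimplification of a
  reduction, i.e. `τ ≅ ρ̄^{ss}`); (iv) `τ ≅ ⊕ ρ̄_i` = `det(X - τ(σ)) = ∏_i det(X - ρ̄_i(σ))` for all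
  `σ` (both sides semisimple), for `ρ̄_i : Γ_F → GL_{m_i}(k)`, `i : Fin d` (the identity forces
  `∑ m_i = n`).  The conditions of (vii) on `ρ̄^{ss}` are stated on `τ`:
  `F(ζ_l) ⊄ F̄^{ker ad ρ̄^{ss}}` ⟺ some `σ ∉ Γ_{F(ζ_l)}` (`absGaloisGroupAdjoinRootsOfUnity F l`) has
  `τ(σ)` scalar (`ad ρ̄^{ss}(σ) = 1`); `F ⊄ F⁺(ζ_l)` ⟺ some `σ ∈ Γ_{F⁺(ζ_l)}` induces `c` on `F`;
  "primitive" ⟺ `kⁿ` has no decomposition `⊕_{j<t} W_j`, `t ≥ 2`, whose summands are permuted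
  transitively by `Γ_F` (a transitive system of imprimitivity with stabiliser `H` is exactly
  `τ ≅ Ind_H θ`, `H ⊋`-proper of finite index and open since it contains `ker τ`); "no quotient of
  order `l`" ⟺ no normal subgroup of index `l` in `τ(Γ_F)`.
* (ii) `∀ᶠ v in cofinite, ρ.IsUnramifiedAt v`; (iii) at every `v ∣ l`, `ρ|_{Γ_{F_v}}` is ordinary of
  some dominant labelled weight (`IsOrdinaryRegularAt v (𝓐 F v) ρ` = Qian's Def. 1.2 = Tho15
  Def. 2.5; `Hom(F, ℚ̄_l) = ⊔_{v∣l} Hom_{ℚ_l}(F_v, ℚ̄_l)`, so a family of dominant local weights is a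
  `λ ∈ (ℤⁿ₊)^{Hom(F,ℚ̄_l)}`); (v) VERBATIM the tree's `FramedGaloisRep.IsSteinbergShapedSSAt v₀ ρ`
  (`SteinbergShapedPlace.lean`, which vendors exactly this hypothesis), `v₀ ∤ l`; (viii) `3 < l`,
  `¬ l ∣ n`.
* (vi): `π : CuspidalAutomorphicRepData n F hcpt` regular algebraic and conjugate self-dual
  (`IsEssConjSelfDual π 1`) — RACSDC —, `ι : ℚ̄_l ≃+* ℂ`, and `r_ι(π)` as a framed `r` which is
  semisimple with the characterising property `HarrisLanTaylorThorne2016.IsCompatible π ι r` (so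
  `r ≅ r_ι(π)` by Chebotarev and Brauer–Nesbitt, as in `Qian2022.IsAutomorphic`).
  (b) for a residual representation `τ'` of `r`: `det(X - τ'(σ)) = det(X - τ(σ))` for all `σ`.
  (a) and (c) concern local components of `π`, which the tree does not extract
  (`SteinbergShapedPlace.lean`, module docstring); they are rendered on `r_ι(π)` through
  local-global compatibility **[Tho15, Thm. 2.2 (3)]: `WD(r_ι(π)|_{G_{F_v}})^{F-ss} ≅ rec^T_{F_v}(ι⁻¹π_v)`
  at every finite `v`** (Caraiani 2012 for `v ∤ l`, Caraiani 2014 for `v ∣ l`):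
  - (c) ⟺ the Weil–Deligne representation attached to `r|_{W_{F_{v₀}}}` (Grothendieck, the tree's
    `IsWeilDeligneOfLadic`, `v₀ ∤ l`) has unramified Weil-group action and monodromy `N` with
    `N^{n-1} ≠ 0`: the Frobenius-semisimple indecomposable Weil–Deligne representations of
    dimension `n` with `N^{n-1} ≠ 0` are the `χ ⊗ Sp_n`, `rec^T(St_n(χ)) = χ' ⊗ Sp_n` with `χ'` an
    unramified twist of `χ`, and `N`, `ρ|_{I}` are unchanged by Frobenius-semisimplification.
  - (a) ⟺ (by **[Tho15, Lemma 2.3]**, the "different, but equivalent definition" of `ι`-ordinary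
    for RACSDC `π` of weight `ιλ`: for each `v ∣ l` there are smooth characters
    `χ_{v,1}, …, χ_{v,n} : F_v^× → ℚ̄_l^×` with (1)
    `val_l(χ_{v,i}(ϖ_v)) = e_v⁻¹ ∑_{τ : F_v ↪ ℚ̄_l} (λ_{τ,n+1-i} - (n-1)/2 + i - 1)` and (2) `π_v` a
    subquotient of `n-Ind(ιχ_{v,1} ⊗ ⋯ ⊗ ιχ_{v,n})`) the clause `(vi)(a′)` below: at every `v ∣ l`,
    `r|_{Γ_{F_v}}` is ordinary of a dominant labelled weight `μ_v` AND there are characters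
    `χ̃_1, …, χ̃_n : W_{F_v} → ℚ̄_l^×` with open kernels such that the Weil–Deligne representation
    `W` attached to `r|_{Γ_{F_v}}` by Fontaine's `WD ∘ D_pst` (the pinned datum
    `fontainePstAdicCompletion v l`, `PstWeilDeligneData.IsWeilDeligneOf`) has
    `det(X - W(w)) = ∏_i (X - χ̃_i(w))` for all `w ∈ W_{F_v}`, and
    `‖χ̃_i(Φ)‖ = l^{-e_v⁻¹ ∑_τ (μ_{v,τ,n+1-i} + i - 1)}` for every geometric Frobenius `Φ`
    (`deg Φ = -1`).  Translation: `χ̃_i = (χ_{v,i} · ι⁻¹|·|^{(1-n)/2}) ∘ Art_{F_v}⁻¹` — Thorne, proof of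
    Thm. 2.4 (p. 796): "Writing `rec^T_{F_v}(ι⁻¹π_v) = (r, N)`, we have
    `r ≅ χ_{v,1}ι⁻¹|·|^{(1-n)/2} ⊕ ⋯ ⊕ χ_{v,n}ι⁻¹|·|^{(1-n)/2}`"; conversely a Weil part with these
    constituents means `ι⁻¹π_v` has supercuspidal support `{χ_{v,i}}`, i.e. is a subquotient of the
    induced representation (Bernstein–Zelevinsky); `|ϖ_v|^{(1-n)/2} = q_v^{(n-1)/2}` shifts the
    valuation in (1) by `f_v(n-1)/2 = e_v⁻¹ ∑_τ (n-1)/2`, whence the exponent above, and `val_l` is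
    `-log_l ‖·‖` on `ℚ̄_l` (`‖l‖ = l⁻¹`).  The weight: by [Tho15, Cor. 2.6] an `ι`-ordinary `π` of
    weight `ιλ` has `r_ι(π)` ordinary of weight `λ`, and conversely ordinarity of weight `μ_v` forces
    `HT_τ = {μ_{v,τ,n+1-i} + i - 1}_i = {λ_{τ,n+1-i} + i - 1}_i` ([Tho15, Thm. 2.2 (2)]), two strictly
    increasing lists, so `μ_v = λ|_v`; thus `(vi)(a′) ⟺ (vi)(a)` for `r ≅ r_ι(π)`.
    (Lean index `i : Fin n` is the printed `i + 1`, and `μ τ i.rev + i` is the printed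
    `μ_{τ,n+1-i} + i - 1`, the convention of `OrdinaryRegular`.)
* Conclusion WEAKENED to `Qian2022.IsAutomorphic ι ρ` ("`ρ ≅ r_ι(Π)` for a regular algebraic
  cuspidal `Π`"); `ι`-ordinarity and conjugate self-duality of `Π` are dropped.
-- TODO(general form): the conclusion "`Π` is `ι`-ordinary RACSDC" once local components `π_v` and
-- Hida's ordinary idempotent are in the tree; then (vi)(a), (vi)(c) verbatim on `π`.

## References

* [AllenNewtonThorne2020] Compositio Math. 156 (2020), Thm. 1.1 (pp. 2399–2400) = Thm. 6.1
  (pp. 2418–2419); §1.1 (pp. 2401–2402).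
* [Thorne2014] J. A. Thorne, J. Amer. Math. Soc. 28 (2015), Thm. 2.2, Lemma 2.3, Thm. 2.4 (proof,
  p. 796), Def. 2.5, Cor. 2.6.
* [Caraiani2012] [Caraiani2014] local-global compatibility at `v ∤ l` and `v ∣ l`.
* [BernsteinZelevinsky1977] supercuspidal support and subquotients of principal series.
* [Qian2022] L. Qian, Invent. Math. 231 (2023), Def. 1.2–1.3.
-/

noncomputable section

open scoped MatrixGroups NumberField Classical
open NumberField IsDedekindDomain Field Filter Polynomial
open Literature.NumberTheory.GaloisRepresentations Literature.NumberTheory.PAdicHodge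

namespace Literature.NumberTheory.Automorphic

namespace AllenNewtonThorne2020

/-- **Allen–Newton–Thorne 2020, Thm. 1.1 (= Thm. 6.1)**, NAMED FACT, relative to local Artin data
`𝓐`.  For `F` imaginary CM (`F⁺` its maximal real subfield, `c̃ ∈ Γ_{F⁺}` inducing complex
conjugation), `n ≥ 2`, a prime `l > 3` with `l ∤ n` ((viii)), `ι : ℚ̄_l ≃ ℂ`, and a continuous
semisimple `ρ : Γ_F → GL_n(ℚ̄_l)`, IF (i) `ρ^c ≅ ρ^∨ ε^{1-n}` (characteristic-polynomial form);
(ii) `ρ` is unramified at almost all places; (iii) `ρ` is ordinary of a dominant labelled weight at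
every `v ∣ l`; (iv) a residual representation `τ = ρ̄^{ss}` of `ρ` has `det(X - τ σ) = ∏_i det(X - ρ̄_i σ)`
with each `ρ̄_i : Γ_F → GL_{m_i}(ℤ̄_l/𝔪)` absolutely irreducible, `ρ̄_i^c ≅ ρ̄_i^∨ ε̄^{1-n}`, pairwise
non-isomorphic; (v) `ρ` is Steinberg-shaped up to semisimplification at a finite `v₀ ∤ l`
(`IsSteinbergShapedSSAt`); (vi) there are a RACSDC `π` (cuspidal, regular algebraic, conjugate
self-dual) and a semisimple framed `r` with the characterising property of `r_ι(π)` such that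
(a′) at every `v ∣ l`, `r` is ordinary of a dominant labelled weight `μ_v` and the Weil–Deligne
representation of `r|_{Γ_{F_v}}` (Fontaine datum) has Weil part with characteristic polynomials
`∏_i (X - χ̃_i(w))` for smooth characters `χ̃_i` of `W_{F_v}` with
`‖χ̃_i(Φ)‖ = l^{-e_v⁻¹ ∑_τ (μ_{v,τ,n+1-i}+i-1)}` at geometric Frobenii `Φ` — [Tho15, Lemma 2.3] with
[Tho15, Thm. 2.2 (3)], i.e. `π` is `ι`-ordinary —, (b) a residual representation `τ'` of `r` has the
characteristic polynomials of `τ` (`r̄_ι(π)^{ss} ≅ ρ̄^{ss}`), (c′) the Weil–Deligne representation of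
`r|_{W_{F_{v₀}}}` is unramified on the Weil group with `N^{n-1} ≠ 0` (i.e. `π_{v₀}` is an unramified
twist of Steinberg, by [Tho15, Thm. 2.2 (3)]); (vii) some `σ ∉ Γ_{F(ζ_l)}` has `τ(σ)` scalar, some
`σ ∈ Γ_{F⁺(ζ_l)}` induces `c` on `F`, each `ρ̄_i|_{Γ_{F(ζ_l)}}` is absolutely irreducible and these
restrictions are pairwise non-isomorphic, `τ` admits no transitive system of imprimitivity with
`≥ 2` blocks, and `τ(Γ_F)` has no normal subgroup of index `l`; THEN `ρ` is automorphic
(`Qian2022.IsAutomorphic ι ρ`).  Printed theorem and the clause-by-clause rendering are in the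
module docstring.
[cite: AllenNewtonThorne2020, Thm. 1.1 (pp. 2399–2400) = Thm. 6.1 (pp. 2418–2419), §1.1]
[cite: Thorne2014, Thm. 2.2, Lemma 2.3, Def. 2.5, Cor. 2.6] -/
def automorphyLifting_residuallyReducible_ordinary
    (𝓐 : ∀ (K : Type) [Field K] [NumberField K] (v : HeightOneSpectrum (𝓞 K)),
      LocalArtinData (v.adicCompletion K)) : Prop :=
  ∀ (F : Type) [Field F] [NumberField F] [IsCMField F],
    ∀ (n : ℕ), 2 ≤ n →
    -- (viii) `l > 3`, `l ∤ n`
    ∀ (l : ℕ) [Fact l.Prime], 3 < l → ¬ l ∣ n →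
    ∀ (hcpt : isCompact_glFiniteIntegralLevel n F) (ι : PadicAlgCl l ≃+* ℂ)
      (ρ : FramedGaloisRep F (PadicAlgCl l) n)
      (c : absoluteGaloisGroup (maximalRealSubfield F))
      (ιk : ZMod l →+* padicAlgClResidueField l)
      (τ : absoluteGaloisGroup F →* GL (Fin n) (padicAlgClResidueField l))
      (d : ℕ) (m : Fin d → ℕ)
      (ρc : (i : Fin d) → (absoluteGaloisGroup F →* GL (Fin (m i)) (padicAlgClResidueField l)))
      (v₀ : HeightOneSpectrum (𝓞 F))
      (π : CuspidalAutomorphicRepData n F hcpt) (r : FramedGaloisRep F (PadicAlgCl l) n)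
      (τ' : absoluteGaloisGroup F →* GL (Fin n) (padicAlgClResidueField l)),
      -- `c` induces the complex conjugation of the CM field `F`
      absGaloisQuot (maximalRealSubfield F) F c = IsCMField.complexConj F →
      -- `ρ` is semisimple
      ρ.toGaloisRep.IsSemisimple →
      -- (i) `ρ^c ≅ ρ^∨ ⊗ ε^{1-n}`, characteristic-polynomial form
      (∀ σ : absoluteGaloisGroup F,
        ((FramedGaloisRep.outerConj c ρ σ : GL (Fin n) (PadicAlgCl l)) :
            Matrix (Fin n) (Fin n) (PadicAlgCl l)).charpoly =
          (((Units.map (algebraMap ℤ_[l] (PadicAlgCl l)).toMonoidHom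
                (GaloisRep.cyclotomicCharacter F l σ) ^ (1 - (n : ℤ)) : (PadicAlgCl l)ˣ) :
              PadicAlgCl l) •
            (((ρ σ)⁻¹ : GL (Fin n) (PadicAlgCl l)) : Matrix (Fin n) (Fin n) (PadicAlgCl l))).charpoly) →
      -- (ii) finitely ramified
      (∀ᶠ v : HeightOneSpectrum (𝓞 F) in cofinite, ρ.IsUnramifiedAt v) →
      -- (iii) ordinary of a dominant labelled weight at every `v ∣ l`
      (∀ v : HeightOneSpectrum (𝓞 F), ((l : ℕ) : 𝓞 F) ∈ v.asIdeal →
        ρ.IsOrdinaryRegularAt v (𝓐 F v)) →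
      -- (iv) `τ = ρ̄^{ss} ≅ ⊕_i ρ̄_i`, `ρ̄_i` absolutely irreducible, `ρ̄_i^c ≅ ρ̄_i^∨ ε̄^{1-n}`,
      -- pairwise non-isomorphic
      ρ.IsResidualRepOf (RingHom.id _) τ →
      (∀ σ : absoluteGaloisGroup F,
        ((τ σ : GL (Fin n) (padicAlgClResidueField l)) :
            Matrix (Fin n) (Fin n) (padicAlgClResidueField l)).charpoly =
          ∏ i : Fin d, ((ρc i σ : GL (Fin (m i)) (padicAlgClResidueField l)) :
            Matrix (Fin (m i)) (Fin (m i)) (padicAlgClResidueField l)).charpoly) →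
      (∀ i : Fin d, IsAbsIrreducible (ρc i)) →
      (∀ (i : Fin d) (σ : absoluteGaloisGroup F),
        ((ρc i (absGaloisOuterConj (maximalRealSubfield F) F c σ) :
            GL (Fin (m i)) (padicAlgClResidueField l)) :
              Matrix (Fin (m i)) (Fin (m i)) (padicAlgClResidueField l)).charpoly =
          ((((Units.map ιk.toMonoidHom (modPCyclotomicCharacterZMod F l σ)) ^ (1 - (n : ℤ)) :
                (padicAlgClResidueField l)ˣ) : padicAlgClResidueField l) •
            (((ρc i σ)⁻¹ : GL (Fin (m i)) (padicAlgClResidueField l)) :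
              Matrix (Fin (m i)) (Fin (m i)) (padicAlgClResidueField l))).charpoly) →
      (∀ i j : Fin d, i ≠ j → ∃ σ : absoluteGaloisGroup F,
        ((ρc i σ : GL (Fin (m i)) (padicAlgClResidueField l)) :
            Matrix (Fin (m i)) (Fin (m i)) (padicAlgClResidueField l)).charpoly ≠
          ((ρc j σ : GL (Fin (m j)) (padicAlgClResidueField l)) :
            Matrix (Fin (m j)) (Fin (m j)) (padicAlgClResidueField l)).charpoly) →
      -- (v) the Steinberg-shaped place `v₀ ∤ l`
      ((l : ℕ) : 𝓞 F) ∉ v₀.asIdeal → ρ.IsSteinbergShapedSSAt v₀ →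
      -- (vi) `π` RACSDC; `r ≅ r_ι(π)` (semisimple with the characterising property)
      π.1.IsRegularAlgebraic → π.1.IsEssConjSelfDual 1 →
      HarrisLanTaylorThorne2016.IsCompatible π.1 ι r → r.toGaloisRep.IsSemisimple →
      -- (vi)(a′) `π` is `ι`-ordinary: [Tho15, Lemma 2.3] transported by [Tho15, Thm. 2.2 (3)]
      (∀ (v : HeightOneSpectrum (𝓞 F)) (hv : ((l : ℕ) : 𝓞 F) ∈ v.asIdeal),
        ∃ wt : LabelledWeight (v.adicCompletion F) (PadicAlgCl l) n,
          wt.IsDominant ∧ r.IsOrdinaryOfLabelledWeightAt v (𝓐 F v) wt ∧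
          ∃ χ : (Fin n → (WeilGroup (v.adicCompletion F) →* (PadicAlgCl l)ˣ)),
            (∀ i : Fin n, IsOpen ((χ i).ker : Set (WeilGroup (v.adicCompletion F)))) ∧
            (∀ (i : Fin n) (w : WeilGroup (v.adicCompletion F)), WeilGroup.deg w = -1 →
              ‖((χ i w : (PadicAlgCl l)ˣ) : PadicAlgCl l)‖ =
                (l : ℝ) ^ (-(((v.asIdeal.ramificationIdx ℤ : ℕ) : ℝ)⁻¹ *
                    ∑ᶠ lab : HodgeTateLabel (v.adicCompletion F) (PadicAlgCl l),
                      ((wt lab i.rev + ((i : ℕ) : ℤ) : ℤ) : ℝ)))) ∧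
            ∃ W : WeilDeligneRep (v.adicCompletion F) (PadicAlgCl l) (Fin n → PadicAlgCl l),
              (fontainePstAdicCompletion v l hv).IsWeilDeligneOf (r.toLocal v) W ∧
              ∀ w : WeilGroup (v.adicCompletion F),
                (W.ρ w).charpoly = ∏ i : Fin n, (X - C ((χ i w : (PadicAlgCl l)ˣ) : PadicAlgCl l))) →
      -- (vi)(b) `r̄_ι(π)^{ss} ≅ ρ̄^{ss}`
      r.IsResidualRepOf (RingHom.id _) τ' →
      (∀ σ : absoluteGaloisGroup F,
        ((τ' σ : GL (Fin n) (padicAlgClResidueField l)) :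
            Matrix (Fin n) (Fin n) (padicAlgClResidueField l)).charpoly =
          ((τ σ : GL (Fin n) (padicAlgClResidueField l)) :
            Matrix (Fin n) (Fin n) (padicAlgClResidueField l)).charpoly) →
      -- (vi)(c′) `π_{v₀}` is an unramified twist of Steinberg, via [Tho15, Thm. 2.2 (3)]
      (∃ W₀ : WeilDeligneRep (v₀.adicCompletion F) (PadicAlgCl l) (Fin n → PadicAlgCl l),
        IsWeilDeligneOfLadic (FramedRep.toWeilGroupHom (r.toLocal v₀)) W₀ ∧
          WeilGroup.IsUnramifiedRep W₀.ρ ∧ W₀.N ^ (n - 1) ≠ 0) →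
      -- (vii) `F(ζ_l) ⊄ F̄^{ker ad ρ̄^{ss}}`
      (∃ σ : absoluteGaloisGroup F, σ ∉ absGaloisGroupAdjoinRootsOfUnity F l ∧
        ∃ a : padicAlgClResidueField l,
          ((τ σ : GL (Fin n) (padicAlgClResidueField l)) :
              Matrix (Fin n) (Fin n) (padicAlgClResidueField l)) =
            Matrix.scalar (Fin n) a) →
      -- (vii) `F ⊄ F⁺(ζ_l)`
      (∃ σ : absoluteGaloisGroup (maximalRealSubfield F),
        σ ∈ absGaloisGroupAdjoinRootsOfUnity (maximalRealSubfield F) l ∧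
          absGaloisQuot (maximalRealSubfield F) F σ ≠ 1) →
      -- (vii) `ρ̄_i|_{Γ_{F(ζ_l)}}` absolutely irreducible and pairwise non-isomorphic
      (∀ i : Fin d, IsAbsIrreducible ((ρc i).comp (absGaloisGroupAdjoinRootsOfUnity F l).subtype)) →
      (∀ i j : Fin d, i ≠ j → ∃ σ ∈ absGaloisGroupAdjoinRootsOfUnity F l,
        ((ρc i σ : GL (Fin (m i)) (padicAlgClResidueField l)) :
            Matrix (Fin (m i)) (Fin (m i)) (padicAlgClResidueField l)).charpoly ≠
          ((ρc j σ : GL (Fin (m j)) (padicAlgClResidueField l)) :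
            Matrix (Fin (m j)) (Fin (m j)) (padicAlgClResidueField l)).charpoly) →
      -- (vii) `ρ̄^{ss}` primitive: no transitive system of imprimitivity with `≥ 2` blocks
      (¬ ∃ (t : ℕ) (W : Fin t → Submodule (padicAlgClResidueField l)
          (Fin n → padicAlgClResidueField l)),
        2 ≤ t ∧ iSupIndep W ∧ iSup W = ⊤ ∧
          (∀ (σ : absoluteGaloisGroup F) (j : Fin t), ∃ j' : Fin t,
            (W j).map (glRepresentation τ σ) = W j') ∧
          (∀ j j' : Fin t, ∃ σ : absoluteGaloisGroup F,
            (W j).map (glRepresentation τ σ) = W j')) →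
      -- (vii) `ρ̄^{ss}(Γ_F)` has no quotient of order `l`
      (∀ N : Subgroup τ.range, N.Normal → N.index ≠ l) →
      -- conclusion: `ρ` is automorphic
      Qian2022.IsAutomorphic ι ρ

end AllenNewtonThorne2020

end Literature.NumberTheory.Automorphic

end
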